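import Summits.BirchSwinnertonDyer.BirchSwinnertonDyer.Theorems.KimAtThreeDeepLowerAdditiveTorsionEndOfPinned
import Summits.BirchSwinnertonDyer.BirchSwinnertonDyer.Theorems.KimAtThreeDeepLowerOffKatoStratumAssemblyFineKato
import Summits.BirchSwinnertonDyer.BirchSwinnertonDyer.Theorems.KimAtThreeDeepUpperDefectWitnessOfZetaBody
import HarnessLib

/-!
# Route `KimAtThreeKolyvagin` (rung W2), crux 19679 (`DeepLowerAtThreeOffKatoStratum`): the registered `stub_additiveDefect`
# and the crux BY NAME from PUBLISHED facts + ONE binder — the fine Kato package at every torsion exponent (C1₂∀)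
# (cell `bsd-addord`, seat `bsd-addord-w2-acc3` (PROGRAMME PART 1b row (3)), gen 4)

HONEST FRAMING. TOOL / CONDITIONAL assembly theorems only (no definition, no named fact, no `sorry`); nothing asserted,
nothing booked, no mark moved; crux 19679 stays OPEN (its OWNER assembles).  `--supports` stmt-BirchSwinnertonDyer-19679.

## What and why

This seat's gen-4 files put the additive rows of crux 19679 on PUBLISHED facts ([S24] Thm. 4.4 (1)(2) pinned, GZK,
Poitou–Tate) + the fine Kato package, displayed as TWO binders: (C1₂) on the `t = 0` defect rows (acc6 / gen 3) and (C1₂ᵗ)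
on the `t ≥ 1` rows (`KimAtThreeOffStratumTorsionRowsOfFineKatoPinned`, p489329).  Both are ONE object — SOME Kato witnesses of
the `ZetaBody` family with finite-level functionals, (Λ)-clauses and two-exponent riders (ii₂) at the row's torsion exponent
`t` — so the natural construction target is its `∀ t` form (C1₂∀).  This file states the residual with that ONE binder, on the
port-free, S24-DEEP-free LOWER END of `KimAtThreeDeepLowerAdditiveTorsionEndOfPinned` (p488987; deep family of the PINNED facts,
w2-c2 gen 6) with `N₀ = 2` from additivity (n1011-p13 `hstab_two_of_hasAdditiveReductionAt`, acc1 `hasAdditiveReductionAt_of_addv`):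

* §1 `fineKato₂_of_fineKatoAll : (C1₂∀) → (C1₂)` and `fineKatoT_of_fineKatoAll : (C1₂∀) → (C1₂ᵗ)` (specialisations).
* §2 `torsionRows_of_pinned_of_fineKatoAll : [S24](1)(2) → GZK → PT → (C1₂∀) → (R₁)` — the `t ≥ 1` line of gen 3 (row by row:
  w2-c3's certificate supply `certSupply_of_addv`, the package at the row's `t`, the pinned END at `N₀ = 2`).
* §3 **`stub19679_additiveDefect_of_fineKatoAll : [S24](1)(2) → GZK → PT → (C1₂∀) → ⟨19679 stub VERBATIM⟩`** (gen 3's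
  `stub19679_additiveDefect_of_fineKato_of_torsionRows` fed by §1/§2).
* §4 `deepLowerAtThreeOffKatoStratum_of_cornerKeys_of_fineKatoAll` — crux 19679 BY NAME ⟸ seat acc2 gen 3's non-additive inputs
  (eleven named published facts + rung-K3 leaf `SignedSupersingular` + `X11a.TargetThree` + (TD)) + [S24] + GZK + PT + (C1₂∀)
  (gen 3's §A `deepLowerAtThreeOffKatoStratum_of_stubs`); §5 the parent 19075 BY NAME via w2-c2's §L glue on the alias 19678.

NET for the planner's residual of record: on the ADDITIVE rows of 19679 / 19075 the ONLY non-published displayed input is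
(C1₂∀); no port, no S24-DEEP flag, no (R₁), no torsion / defect case split in the display.  Credit: acc2 gen 3, acc6, w2-c2,
w2-c3, w2-c4, w2-c5, kim3, acc1, team n1011; this seat composes.
References: [Kato2004Asterisque] (8.1.3), §9.4, Thm. 9.7, Thm. 6.6 (1), Ex. 13.3; [Kim2022StructureSelmer] Thm. 1.9 (6), Thm. 3.13;
[MazurRubin2004] Thm. 3.2.4, Thm. 5.2.12, App. A Prop. A.2; [Sakamoto2024] Thm. 4.4 (1)(2); [Kim2025RefinedTNC] Thm 1.1, §8.1.2;
[YanZhu2024MainConjNonCM] Thm. 4.15; [Wuthrich2014] Lemma 20, Prop. 21; [Skinner2016PacificMC] Thm. C; [Miller2011LMS] Thm. 1.2;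
[Mazur1978] Cor. 4.1; [Ribet1990] Thm. 1.1; [SilvermanATAEC1994] IV.9.2; [TateGCFT1967] §2.4.
-/

set_option autoImplicit false
-- the Theorems namespace of a single-conjunct summit repeats the summit name by design (D-0017)
set_option linter.dupNamespace false

noncomputable section

open scoped NumberField TensorProduct ContRepresentation Classical MatrixGroups ModularForm
open Field Finset IsDedekindDomain NumberField WeierstrassCurve Rat.HeightOneSpectrum CongruenceSubgroup
open Literature.NumberTheory.GaloisRepresentations Literature.NumberTheory.GaloisCohomology
open Literature.NumberTheory.GaloisRepresentations.DiscreteGaloisModule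
open Literature.NumberTheory.EllipticCurves Literature.NumberTheory.EllipticCurves.ModularForms
open Literature.NumberTheory.EllipticCurves.Rank1Residual
open Literature.NumberTheory.EllipticCurves.Rank1Residual.Typed
open Literature.NumberTheory.EllipticCurves.Skinner2016
open Literature.NumberTheory.Automorphic
open Literature.NumberTheory.EllipticCurves.Kato2004
open Literature.NumberTheory.EllipticCurves.Kato2004.EulerSystemValues
open Summit.BirchSwinnertonDyer.Rank1Residual
open Summit.BirchSwinnertonDyer.Rank1Residual.GaloisImage
open Summit.BirchSwinnertonDyer.BirchSwinnertonDyer.Theses.KimAtThreeKolyvagin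
open Summit.BirchSwinnertonDyer.BirchSwinnertonDyer.Theorems
open Summit.BirchSwinnertonDyer.BirchSwinnertonDyer.Theorems.Rank1ResidualX1Defs
open Summit.BirchSwinnertonDyer.BirchSwinnertonDyer.Theorems.KimAtThreeKolyvaginDefs
open Summit.BirchSwinnertonDyer.BirchSwinnertonDyer.Theorems.KimAtThreeKolyvaginPortShared
open Summit.BirchSwinnertonDyer.BirchSwinnertonDyer.Theorems.KimAtThreeDeepUpperCertSupplyDefect
open Summit.BirchSwinnertonDyer.BirchSwinnertonDyer.Theorems.KimAtThreeDeepLowerOffStratumAdditiveDefectPortTwoExp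
open Summit.BirchSwinnertonDyer.BirchSwinnertonDyer.Theorems.KimAtThreeOffStratumAdditiveDefectOfFineKato
open Summit.BirchSwinnertonDyer.BirchSwinnertonDyer.Theorems.KimAtThreeDeepLowerOffStratumCornerKeysSharp
open Summit.BirchSwinnertonDyer.BirchSwinnertonDyer.Theorems.KimAtThreeDeepLowerSplitGlue
open Summit.BirchSwinnertonDyer.BirchSwinnertonDyer.Theorems.KimAtThreeDeepLowerOffKatoStratumAssemblyFineKato
open Summit.BirchSwinnertonDyer.BirchSwinnertonDyer.Theorems.KimAtThreeDeepLowerAdditiveTorsionEndOfPinned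

namespace Summit.BirchSwinnertonDyer.BirchSwinnertonDyer.Theorems.KimAtThreeOffStratumAdditiveOfFineKatoAll

/-- Local notation: the TWO-EXPONENT rider clause (ii₂) at depth `j`, torsion exponent `t`, defect exponent
`e`, place `v`, for the pair `(Λ, Λf)` (n1011's `KatoExpStarFiniteLevelAt` clause (ii), conclusion `× 3^e`). -/
local notation3 (prettyPrint := false) "RIDER₂⟦" W' ", " j ", " t' ", " e' ", " v' ", " Λ' ", " Λf "⟧" =>
  ∀ (r : Finset (HeightOneSpectrum (𝓞 ℚ)))
    (Ψ : H1 (tateRep W' 3) (cycSubgroup 3 0 r) →+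
      continuousCohomology 1
        (subgroupRep (WeierstrassCurve.torsionGaloisModule W' (((3 : ℕ) : ℤ) ^ j * ((3 : ℕ) : ℤ))).toTopRep
          (cycSubgroup 3 0 r))),
    (∀ (φ : contOneCocycles (subgroupRep (tateRep W' 3).toTopRep (cycSubgroup 3 0 r)))
        (ψ : contOneCocycles
          (subgroupRep (WeierstrassCurve.torsionGaloisModule W' (((3 : ℕ) : ℤ) ^ j * ((3 : ℕ) : ℤ))).toTopRep
            (cycSubgroup 3 0 r))),
        (∀ g, ((ψ.1 g : geomTorsion W' (((3 : ℕ) : ℤ) ^ j * ((3 : ℕ) : ℤ))) : geomPoints W') =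
          TateModule.proj 3 (j + 1) (φ.1 g)) →
        Ψ (oneCocycleClass _ φ) = oneCocycleClass _ ψ) →
    ∀ (y : H1 (tateRep W' 3) (cycSubgroup 3 0 r))
      (κ₀ : galoisCohomology (WeierstrassCurve.torsionGaloisModule W' (((3 : ℕ) : ℤ) ^ j * ((3 : ℕ) : ℤ))) 1)
      (s : ℤ_[3]),
      resSubgroup (WeierstrassCurve.torsionGaloisModule W' (((3 : ℕ) : ℤ) ^ j * ((3 : ℕ) : ℤ))).toTopRep
          (cycSubgroup 3 0 r) 1 κ₀ = Ψ y →
      galoisCohomology.localization (WeierstrassCurve.torsionGaloisModule W' (((3 : ℕ) : ℤ) ^ j * ((3 : ℕ) : ℤ)))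
          (Sum.inr v') 1 κ₀ ∈ propagatedSelmerStructure W' 3 j (Sum.inr v') →
      (∃ l ∈ cycIntLattice 3 (cycLevel 3 0 r),
          (((3 : ℕ) : ℤ_[3]) ^ t') • Λ' 0 r y - ((s : ℚ_[3]) ⊗ₜ[ℚ] (1 : CyclotomicField (cycLevel 3 0 r) ℚ)) =
            (((3 : ℕ) : ℤ_[3]) ^ (j + 1)) • (l : ℚ_[3] ⊗[ℚ] CyclotomicField (cycLevel 3 0 r) ℚ)) →
      ((3 ^ e' : ℕ) : ZMod (3 ^ (j + 1))) *
        Λf (galoisCohomology.localization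
          (WeierstrassCurve.torsionGaloisModule W' (((3 : ℕ) : ℤ) ^ j * ((3 : ℕ) : ℤ))) (Sum.inr v') 1 κ₀) =
        PadicInt.toZModPow (j + 1) s

/-- Local notation: **(C1₂) the FINE KATO PACKAGE in two-exponent form** on the additive-defect rows. -/
local notation3 (prettyPrint := false) "FINEKATO₂" =>
  ∀ (W : WeierstrassCurve ℚ) [W.IsElliptic] [W.IsGloballyMinimal]
    [ContinuousSMul ℤ_[3] (W.tateModule 3)] [Module.Free ℤ_[3] (W.tateModule 3)]
    [Module.Finite ℤ_[3] (W.tateModule 3)],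
    (∀ m : ℕ, W.HasSurjectiveModNGaloisRep (3 ^ m : ℕ)) →
    (haveI : Fact (Nat.Prime 3) := ⟨Nat.prime_three⟩; Addv W 3) →
    Nat.card {Q : (W.baseChange ℚ_[3]).toAffine.Point // (3 : ℕ) • Q = 0} = 1 →
    ∀ (v₃ : HeightOneSpectrum (𝓞 ℚ)), ((3 : ℕ) : 𝓞 ℚ) ∈ v₃.asIdeal →
    ∀ {N : ℕ} [NeZero N] (P : ModularParametrizationData W N), N = W.conductorNorm ℤ →
      (∀ z ∈ P.L.lattice, ∃ w ∈ periodLattice P.f, z = P.c * w) →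
      (3 ∣ (W.baseChange ℚ_[3]).localTamagawaNumber ℤ_[3] ∨ (3 : ℤ) ∣ P.maninConstant) →
      ∃ (ι : (n : ℕ) → (CyclotomicField n ℚ →+* ℂ)) (κK : ℝ)
        (Λ : ∀ (k' : ℕ) (r : Finset (HeightOneSpectrum (𝓞 ℚ))),
          H1 (tateRep W 3) (cycSubgroup 3 k' r) →ₗ[ℤ_[3]]
            ℚ_[3] ⊗[ℚ] CyclotomicField (cycLevel 3 k' r) ℚ)
        (Λfin : ∀ j : ℕ, galoisCohomology
          ((W.torsionGaloisModule (((3 : ℕ) : ℤ) ^ j * ((3 : ℕ) : ℤ))).toLocal (Sum.inr v₃)) 1 →+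
            ZMod (3 ^ (j + 1))) (e : ℕ),
        κK ≠ 0 ∧ (∃ u : ℚ, (u : ℝ) = κK ∧ padicValRat 3 u = 0) ∧
        (∀ j : ℕ,
          (∀ c : ZMod (3 ^ (j + 1)), ∃ x ∈ propagatedSelmerStructure W 3 j (Sum.inr v₃), Λfin j x = c) ∧
          (∀ x ∈ propagatedSelmerStructure W 3 j (Sum.inr v₃),
            Λfin j x = 0 ↔ x ∈ W.kummerSelmerStructure (((3 : ℕ) : ℤ) ^ j * ((3 : ℕ) : ℤ)) (Sum.inr v₃))) ∧
        (∀ j : ℕ, RIDER₂⟦W, j, 0, e, v₃, Λ, Λfin j⟧) ∧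
        ∀ (c d a : ℤ) (A : ℕ), 0 < A → Int.gcd c (6 * 3 * A) = 1 → Int.gcd d (6 * 3 * N) = 1 →
          ∃ (z : ∀ (k' : ℕ) (r : (cyclotomicLevelsRat 3 (badPlaces c d A N)).Ideals),
                H1 (tateRep W 3) ((cyclotomicLevelsRat 3 (badPlaces c d A N)).level k' r.1))
            (x : ∀ (k' : ℕ) (r : (cyclotomicLevelsRat 3 (badPlaces c d A N)).Ideals),
                CyclotomicField (cycLevel 3 k' r.1) ℚ),
            ZetaBody W 3 P.f ι κK Λ c d a A z x

/-- Local notation: **(C1₂ᵗ) the FINE KATO PACKAGE in two-exponent form on the additive rows with `#E(ℚ₃)[3] = 3^t`,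
`1 ≤ t`** — (C1₂) with the row binders `#E(ℚ₃)[3] = 1`, `3 ∣ c₃ ∨ 3 ∣ c_P` replaced by `1 ≤ t`, `#E(ℚ₃)[3] = 3^t`, and
the rider clause (ii₂) read at torsion exponent `t` (the SAME object: SOME Kato witnesses of the `ZetaBody` family with
finite-level functionals, (Λ)-clauses and two-exponent riders for ONE `e`; CONSTRUCTION-SHAPED, never `_holds`). -/
local notation3 (prettyPrint := false) "FINEKATOᵀ" =>
  ∀ (W : WeierstrassCurve ℚ) [W.IsElliptic] [W.IsGloballyMinimal]
    [ContinuousSMul ℤ_[3] (W.tateModule 3)] [Module.Free ℤ_[3] (W.tateModule 3)]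
    [Module.Finite ℤ_[3] (W.tateModule 3)],
    (∀ m : ℕ, W.HasSurjectiveModNGaloisRep (3 ^ m : ℕ)) →
    (haveI : Fact (Nat.Prime 3) := ⟨Nat.prime_three⟩; Addv W 3) →
    ∀ (t : ℕ), 1 ≤ t → Nat.card {Q : (W.baseChange ℚ_[3]).toAffine.Point // (3 : ℕ) • Q = 0} = 3 ^ t →
    ∀ (v₃ : HeightOneSpectrum (𝓞 ℚ)), ((3 : ℕ) : 𝓞 ℚ) ∈ v₃.asIdeal →
    ∀ {N : ℕ} [NeZero N] (P : ModularParametrizationData W N), N = W.conductorNorm ℤ →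
      (∀ z ∈ P.L.lattice, ∃ w ∈ periodLattice P.f, z = P.c * w) →
      ∃ (ι : (n : ℕ) → (CyclotomicField n ℚ →+* ℂ)) (κK : ℝ)
        (Λ : ∀ (k' : ℕ) (r : Finset (HeightOneSpectrum (𝓞 ℚ))),
          H1 (tateRep W 3) (cycSubgroup 3 k' r) →ₗ[ℤ_[3]]
            ℚ_[3] ⊗[ℚ] CyclotomicField (cycLevel 3 k' r) ℚ)
        (Λfin : ∀ j : ℕ, galoisCohomology
          ((W.torsionGaloisModule (((3 : ℕ) : ℤ) ^ j * ((3 : ℕ) : ℤ))).toLocal (Sum.inr v₃)) 1 →+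
            ZMod (3 ^ (j + 1))) (e : ℕ),
        κK ≠ 0 ∧ (∃ u : ℚ, (u : ℝ) = κK ∧ padicValRat 3 u = 0) ∧
        (∀ j : ℕ,
          (∀ c : ZMod (3 ^ (j + 1)), ∃ x ∈ propagatedSelmerStructure W 3 j (Sum.inr v₃), Λfin j x = c) ∧
          (∀ x ∈ propagatedSelmerStructure W 3 j (Sum.inr v₃),
            Λfin j x = 0 ↔ x ∈ W.kummerSelmerStructure (((3 : ℕ) : ℤ) ^ j * ((3 : ℕ) : ℤ)) (Sum.inr v₃))) ∧
        (∀ j : ℕ, RIDER₂⟦W, j, t, e, v₃, Λ, Λfin j⟧) ∧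
        ∀ (c d a : ℤ) (A : ℕ), 0 < A → Int.gcd c (6 * 3 * A) = 1 → Int.gcd d (6 * 3 * N) = 1 →
          ∃ (z : ∀ (k' : ℕ) (r : (cyclotomicLevelsRat 3 (badPlaces c d A N)).Ideals),
                H1 (tateRep W 3) ((cyclotomicLevelsRat 3 (badPlaces c d A N)).level k' r.1))
            (x : ∀ (k' : ℕ) (r : (cyclotomicLevelsRat 3 (badPlaces c d A N)).Ideals),
                CyclotomicField (cycLevel 3 k' r.1) ℚ),
            ZetaBody W 3 P.f ι κK Λ c d a A z x

/-- Local notation: **(C1₂∀) the FINE KATO PACKAGE in two-exponent form on EVERY additive tower row, at its torsion exponent `t`**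
(`#E(ℚ₃)[3] = 3^t`, any `t ≥ 0`; lattice-optimal `P` at the conductor) — ONE binder implying both (C1₂) (the `t = 0` defect rows)
and (C1₂ᵗ) (the `t ≥ 1` rows): SOME Kato witnesses of the `ZetaBody` family with finite-level functionals satisfying the
(Λ)-clauses and the two-exponent riders (ii₂) at torsion exponent `t` for ONE `e`.  CONSTRUCTION-SHAPED, never `_holds`; the
recommended `∀ t` form of the (C1) construction target (`defn-BlochKatoDualExponential` lane). -/
local notation3 (prettyPrint := false) "FINEKATOALL" =>
  ∀ (W : WeierstrassCurve ℚ) [W.IsElliptic] [W.IsGloballyMinimal]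
    [ContinuousSMul ℤ_[3] (W.tateModule 3)] [Module.Free ℤ_[3] (W.tateModule 3)]
    [Module.Finite ℤ_[3] (W.tateModule 3)],
    (∀ m : ℕ, W.HasSurjectiveModNGaloisRep (3 ^ m : ℕ)) →
    (haveI : Fact (Nat.Prime 3) := ⟨Nat.prime_three⟩; Addv W 3) →
    ∀ (t : ℕ), Nat.card {Q : (W.baseChange ℚ_[3]).toAffine.Point // (3 : ℕ) • Q = 0} = 3 ^ t →
    ∀ (v₃ : HeightOneSpectrum (𝓞 ℚ)), ((3 : ℕ) : 𝓞 ℚ) ∈ v₃.asIdeal →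
    ∀ {N : ℕ} [NeZero N] (P : ModularParametrizationData W N), N = W.conductorNorm ℤ →
      (∀ z ∈ P.L.lattice, ∃ w ∈ periodLattice P.f, z = P.c * w) →
      ∃ (ι : (n : ℕ) → (CyclotomicField n ℚ →+* ℂ)) (κK : ℝ)
        (Λ : ∀ (k' : ℕ) (r : Finset (HeightOneSpectrum (𝓞 ℚ))),
          H1 (tateRep W 3) (cycSubgroup 3 k' r) →ₗ[ℤ_[3]]
            ℚ_[3] ⊗[ℚ] CyclotomicField (cycLevel 3 k' r) ℚ)
        (Λfin : ∀ j : ℕ, galoisCohomology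
          ((W.torsionGaloisModule (((3 : ℕ) : ℤ) ^ j * ((3 : ℕ) : ℤ))).toLocal (Sum.inr v₃)) 1 →+
            ZMod (3 ^ (j + 1))) (e : ℕ),
        κK ≠ 0 ∧ (∃ u : ℚ, (u : ℝ) = κK ∧ padicValRat 3 u = 0) ∧
        (∀ j : ℕ,
          (∀ c : ZMod (3 ^ (j + 1)), ∃ x ∈ propagatedSelmerStructure W 3 j (Sum.inr v₃), Λfin j x = c) ∧
          (∀ x ∈ propagatedSelmerStructure W 3 j (Sum.inr v₃),
            Λfin j x = 0 ↔ x ∈ W.kummerSelmerStructure (((3 : ℕ) : ℤ) ^ j * ((3 : ℕ) : ℤ)) (Sum.inr v₃))) ∧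
        (∀ j : ℕ, RIDER₂⟦W, j, t, e, v₃, Λ, Λfin j⟧) ∧
        ∀ (c d a : ℤ) (A : ℕ), 0 < A → Int.gcd c (6 * 3 * A) = 1 → Int.gcd d (6 * 3 * N) = 1 →
          ∃ (z : ∀ (k' : ℕ) (r : (cyclotomicLevelsRat 3 (badPlaces c d A N)).Ideals),
                H1 (tateRep W 3) ((cyclotomicLevelsRat 3 (badPlaces c d A N)).level k' r.1))
            (x : ∀ (k' : ℕ) (r : (cyclotomicLevelsRat 3 (badPlaces c d A N)).Ideals),
                CyclotomicField (cycLevel 3 k' r.1) ℚ),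
            ZetaBody W 3 P.f ι κK Λ c d a A z x

/-- Local notation: **(R₁) the `t ≥ 1` additive rows** — the conclusion of crux 19679 DISPLAYED on the additive
optimal tower rows of analytic rank `0` with `#E(ℚ₃)[3] ≠ 1` (binders of the registered stub verbatim, the defect
disjunction replaced by its torsion disjunct; this seat's TorsionSplit §8 `hTors`). -/
local notation3 (prettyPrint := false) "TORSROWS" =>
  ∀ (W₀ : WeierstrassCurve ℚ) [W₀.IsElliptic] [W₀.IsGloballyMinimal],
    (∀ n : ℕ, W₀.HasSurjectiveModNGaloisRep (3 ^ n : ℕ)) → Finite W₀.sha →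
    ∀ {N : ℕ} [NeZero N], N = W₀.conductorNorm ℤ →
    ∀ (D₀ : ModularParametrizationData W₀ N),
      (∀ z ∈ D₀.L.lattice, ∃ w ∈ periodLattice D₀.f, z = D₀.c * w) →
      (∀ (W₂ : WeierstrassCurve ℚ) [W₂.IsElliptic] (D₂ : ModularParametrizationData W₂ N),
        D₂.f = D₀.f → D₀.modularDegree ≤ D₂.modularDegree) →
      (∀ r : ℚ, ratPlusSymbol D₀.f r ≠ 0 → 0 ≤ padicValRat 3 (ratPlusSymbol D₀.f r)) →
      kuriharaVanishingOrder W₀ 3 D₀.f = 0 →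
      (haveI : Fact (Nat.Prime 3) := ⟨Nat.prime_three⟩; Addv W₀ 3) →
      Nat.card {Q : (W₀.baseChange ℚ_[3]).toAffine.Point // (3 : ℕ) • Q = 0} ≠ 1 →
      ∃ d : ℕ, kuriharaPartialDeepInfty W₀ 3 D₀.f = d ∧
        kuriharaPartial W₀ 3 D₀.f 0 ≤
          ((padicValNat 3 (Nat.card (AddCommGroup.primaryComponent W₀.sha 3)) + d : ℕ) : ℕ∞)

/-- Local notation: the registered `stub_additiveDefect` signature of crux 19679 (BC3 birth skeleton e575d030),
VERBATIM. -/
local notation3 (prettyPrint := false) "STUB19679" =>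
  ∀ (W₀ : WeierstrassCurve ℚ) [W₀.IsElliptic] [W₀.IsGloballyMinimal],
    (∀ n : ℕ, W₀.HasSurjectiveModNGaloisRep (3 ^ n : ℕ)) → Finite W₀.sha →
    ∀ {N : ℕ} [NeZero N], N = W₀.conductorNorm ℤ →
    ∀ (D₀ : Literature.NumberTheory.EllipticCurves.ModularForms.ModularParametrizationData W₀ N),
      (∀ z ∈ D₀.L.lattice, ∃ w ∈ Literature.NumberTheory.EllipticCurves.ModularForms.periodLattice D₀.f, z = D₀.c * w) →
      (∀ (W₂ : WeierstrassCurve ℚ) [W₂.IsElliptic]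
        (D₂ : Literature.NumberTheory.EllipticCurves.ModularForms.ModularParametrizationData W₂ N),
        D₂.f = D₀.f → D₀.modularDegree ≤ D₂.modularDegree) →
      (∀ r : ℚ, Literature.NumberTheory.EllipticCurves.ratPlusSymbol D₀.f r ≠ 0 →
        0 ≤ padicValRat 3 (Literature.NumberTheory.EllipticCurves.ratPlusSymbol D₀.f r)) →
      Literature.NumberTheory.EllipticCurves.kuriharaVanishingOrder W₀ 3 D₀.f = 0 →
      (haveI : Fact (Nat.Prime 3) := ⟨Nat.prime_three⟩;
          Literature.NumberTheory.EllipticCurves.Rank1Residual.Addv W₀ 3) →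
      (3 ∣ (W₀.baseChange ℚ_[3]).localTamagawaNumber ℤ_[3] ∨
        Nat.card {Q : (W₀.baseChange ℚ_[3]).toAffine.Point // (3 : ℕ) • Q = 0} ≠ 1 ∨
        (3 : ℤ) ∣ D₀.maninConstant) →
      ∃ d : ℕ, Literature.NumberTheory.EllipticCurves.kuriharaPartialDeepInfty W₀ 3 D₀.f = d ∧
        Literature.NumberTheory.EllipticCurves.kuriharaPartial W₀ 3 D₀.f 0 ≤
          ((padicValNat 3 (Nat.card (AddCommGroup.primaryComponent W₀.sha 3)) + d : ℕ) : ℕ∞)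
/-- Local notation: **(TD)** — Tamagawa divisibility of the deep Kurihara numbers on the NON-ADDITIVE tower rows of
analytic rank `0` with `3 ∣ ∏ c_ℓ` (seat acc2's binder `hTD` VERBATIM; Kim's Conj. 1.10 `≥`-half, deep reading —
displayed, never a fact). -/
local notation3 (prettyPrint := false) "TAMDIV" =>
  ∀ (W : WeierstrassCurve ℚ) [W.IsElliptic] [W.IsGloballyMinimal],
    (∀ n : ℕ, W.HasSurjectiveModNGaloisRep (3 ^ n : ℕ)) →
    ∀ {N : ℕ} [NeZero N] (f : CuspForm (Gamma0 N) 2), IsNewformOf W f →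
    kuriharaVanishingOrder W 3 f = 0 →
    ¬ (haveI : Fact (Nat.Prime 3) := ⟨Nat.prime_three⟩; Addv W 3) → 3 ∣ W.tamagawaProduct →
      ((padicValNat 3 W.tamagawaProduct : ℕ) : ℕ∞) ≤ kuriharaPartialDeepInfty W 3 f

/-! ### §1 (C1₂∀) specialises to (C1₂) and to (C1₂ᵗ) -/

/-- **(C1₂∀) ⟹ (C1₂)**: on a `t = 0` defect row read the package at `t = 0` (`#E(ℚ₃)[3] = 1 = 3^0`).
[cite: Kato2004Asterisque, §9.4 and Thm. 9.7 (pp. 188–189)] -/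
theorem fineKato₂_of_fineKatoAll (hC1 : FINEKATOALL) : FINEKATO₂ :=
  fun W _ _ _ _ _ htow hadd ht1 v₃ hv₃ _ _ P hN hlat _ =>
    hC1 W htow hadd 0 (by rw [ht1, pow_zero]) v₃ hv₃ P hN hlat

/-- **(C1₂∀) ⟹ (C1₂ᵗ)**: forget `1 ≤ t`. [cite: Kato2004Asterisque, §9.4 and Thm. 9.7 (pp. 188–189)] -/
theorem fineKatoT_of_fineKatoAll (hC1 : FINEKATOALL) : FINEKATOᵀ :=
  fun W _ _ _ _ _ htow hadd t _ ht v₃ hv₃ _ _ P hN hlat => hC1 W htow hadd t ht v₃ hv₃ P hN hlat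

/-! ### §2 (R₁) ⟸ [S24] PINNED + GZK + PT + (C1₂∀) -/

/-- **The `t ≥ 1` line (R₁) of this seat's gen 3 ⟸ [S24] Thm. 4.4 (1)(2) PINNED (PUB) + GZK + Poitou–Tate BY NAME + (C1₂∀)**,
row by row: `#E(ℚ₃)[3] = 3^t` (`exists_natCard_threeTorsion_eq_three_pow`), a place `v₃ ∣ 3` and generators `η`, Kato's
auxiliary cusp datum from seat w2-c3's THEOREM `certSupply_of_addv`, the package at the row's `t`, and the port-free,
S24-DEEP-free LOWER END `deepLower_datum_of_zetaBody_of_stable_pinned` at `N₀ = 2` (every additive `E(ℚ₃)` has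
`27·P = 0 → 9·P = 0`).  Nothing asserted. [cite: Kim2025RefinedTNC, Thm 1.1 and §8.1.2] [cite: MazurRubin2004, App. A Prop. A.2 and Thm. 5.2.12]
[cite: Sakamoto2024, Thm. 4.4 (1)(2) (p. 926)] [cite: SilvermanATAEC1994, Cor. IV.9.2 (d)] [cite: TateGCFT1967, §2.4] -/
theorem torsionRows_of_pinned_of_fineKatoAll
    (hS24 : Sakamoto2024.kolyvaginSystems_freeRankOne_zmod_three_pow)
    (hS24₂ : Sakamoto2024.kolyvaginSystems_idealOfBasis_eq_fittingIdeal_zmod_three_pow)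
    (hGZK : rank_eq_analyticRank_of_analyticRank_le_one)
    (hPT : poitouTate_selmerStructure_duality ℚ)
    (hC1 : FINEKATOALL) : TORSROWS := by
  intro W₀ _ _ htow _ N _ hN D₀ hopt _ _ hord hA _
  haveI : Fact (Nat.Prime 3) := ⟨Nat.prime_three⟩
  haveI : ContinuousSMul ℤ_[3] (W₀.tateModule 3) := TateModule.continuousSMul_padicInt
  haveI : Module.Free ℤ_[3] (W₀.tateModule 3) := W₀.module_free_tateModule_holds 3
  haveI : Module.Finite ℤ_[3] (W₀.tateModule 3) := W₀.module_finite_tateModule_holds 3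
  obtain ⟨t, ht⟩ := exists_natCard_threeTorsion_eq_three_pow W₀
  obtain ⟨v₃, ηg, hv₃, hηg⟩ := KimAtThreeShallowEqDeepSplitGlueNoStub.exists_place_three_and_generators
  obtain ⟨c, d, a, A, d', aM, hA0, hcA, hdN, hcdA, hcd, hdd', hAN, haM, hE0, hE, hR0, hR⟩ :=
    certSupply_of_addv W₀ (by simpa using htow 1) hA D₀ hN
  haveI : NeZero A := ⟨hA0.ne'⟩
  obtain ⟨ι, κK, Λ, Λfin, e, hκ0, hNorm, hΛ, hfin₂, hz⟩ := hC1 W₀ htow hA t ht v₃ hv₃ D₀ hN hopt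
  obtain ⟨z, x, hbody⟩ := hz c d a A hA0 hcA hdN
  exact deepLower_datum_of_zetaBody_of_stable_pinned W₀ hS24 hS24₂ hGZK hPT t e 2 hA htow ht hN D₀ v₃ hv₃ ηg hηg hbody
    Λfin hΛ hfin₂ hcdA
    (fun w hw => hstab_two_of_hasAdditiveReductionAt W₀ hw
      (KimAtThreeDeepUpperDefectWitnessOfZetaBody.hasAdditiveReductionAt_of_addv W₀ hA w hw))
    hNorm hκ0 d' hcd hdd' hAN aM haM hE0 hE hR0 hR hord

/-! ### §3 The registered stub of crux 19679 from PUBLISHED facts + (C1₂∀) -/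

/-- **`stub_additiveDefect` of crux 19679 (`DeepLowerAtThreeOffKatoStratum`), TYPE VERBATIM, ⟸ [S24] Thm. 4.4 (1)(2) (PUB,
pinned), GZK (PUB), Poitou–Tate (PUB) + ONE displayed binder, the fine Kato package at every torsion exponent (C1₂∀)** —
gen 3's `stub19679_additiveDefect_of_fineKato_of_torsionRows` fed by §1 (`t = 0` defect rows) and §2 (`t ≥ 1` rows).
Composition with the skeleton's `DeepLowerAtThreeOffKatoStratum_of` is by `exact` on this type.  Crux 19679 stays OPEN.
[cite: Kim2025RefinedTNC, Thm 1.1 and §8.1.2] [cite: Kim2022StructureSelmer, Thm. 1.9 (6), Thm. 3.13]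
[cite: Sakamoto2024, Thm. 4.4 (1)(2) (p. 926)] [cite: MazurRubin2004, Thm. 5.2.12 and App. A Prop. A.2]
[cite: Kato2004Asterisque, §9.4 and Thm. 9.7 (pp. 188–189)] -/
theorem stub19679_additiveDefect_of_fineKatoAll
    (hS24 : Sakamoto2024.kolyvaginSystems_freeRankOne_zmod_three_pow)
    (hS24₂ : Sakamoto2024.kolyvaginSystems_idealOfBasis_eq_fittingIdeal_zmod_three_pow)
    (hGZK : rank_eq_analyticRank_of_analyticRank_le_one)
    (hPT : poitouTate_selmerStructure_duality ℚ)
    (hC1 : FINEKATOALL) : STUB19679 :=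
  stub19679_additiveDefect_of_fineKato_of_torsionRows hS24 hS24₂ hGZK hPT (fineKato₂_of_fineKatoAll hC1)
    (torsionRows_of_pinned_of_fineKatoAll hS24 hS24₂ hGZK hPT hC1)

/-! ### §4 Crux 19679 BY NAME — additive rows on PUB + (C1₂∀) only -/

/-- **Crux `DeepLowerAtThreeOffKatoStratum` (item 19679) BY NAME ⟸ seat acc2 gen 3's non-additive inputs + [S24] (1)(2) (PUB,
pinned) + GZK + PT + (C1₂∀)** — gen 3's §A `deepLowerAtThreeOffKatoStratum_of_stubs` on acc2's ★★★★♯′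
`stub_nonAdditive_of_rungK3_of_x11aThree_sharp_of_tamagawa_le_deepInfty` and §3.  CONDITIONAL: does not close the item;
nothing booked. [cite: Kim2025RefinedTNC, Thm 1.1 and §8.1.2] [cite: Kim2022StructureSelmer, Thm. 1.9 (6), Thm. 3.13, Conj. 1.10 (PDF p. 8)]
[cite: Sakamoto2024, Thm. 4.4 (1)(2) (p. 926)] [cite: MazurRubin2004, Thm. 5.2.12 and App. A Prop. A.2 (pp. 79–80)]
[cite: YanZhu2024MainConjNonCM, Thm. 4.15 (§4.6)] [cite: Wuthrich2014, Lemma 20 and Prop. 21] [cite: Skinner2016PacificMC, Thm. C (§1)]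
[cite: Miller2011LMS, Thm. 1.2, Def. 1.1] [cite: Mazur1978, Cor. 4.1] [cite: Ribet1990, Thm. 1.1]
[cite: Kato2004Asterisque, §9.4 and Thm. 9.7 (pp. 188–189), Ex. 13.3 (pp. 224–225)] -/
theorem deepLowerAtThreeOffKatoStratum_of_cornerKeys_of_fineKatoAll
    (hYZ : YanZhu2026.thm415_padicValRat_bsd_rank_le_one)
    (hW20 : Wuthrich2014.lemma20_surjective_threeAdic_of_semistable)
    (hW : Wuthrich2014.sha_dvd_analyticSha)
    (hSk : Skinner2016.thmC_padicValRat_bsd_rank_zero)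
    (hmod : hasEntireLFunction_rat) (hGZK : rank_eq_analyticRank_of_analyticRank_le_one)
    (hM : mazur_not_dvd_maninConstant_of_odd)
    (hBCDT : exists_isNewformOf) (hLL : diamond1995_refinedSerre)
    (hMi : bsdp_of_irreducible_of_conductor_lt)
    (hS24 : Sakamoto2024.kolyvaginSystems_freeRankOne_zmod_three_pow)
    (hS24₂ : Sakamoto2024.kolyvaginSystems_idealOfBasis_eq_fittingIdeal_zmod_three_pow)
    (hPT : poitouTate_selmerStructure_duality ℚ)
    (hK3 : Supersingular.SignedSupersingular) (hT3 : X11a.TargetThree) (hTD : TAMDIV)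
    (hC1 : FINEKATOALL) :
    DeepLowerAtThreeOffKatoStratum :=
  deepLowerAtThreeOffKatoStratum_of_stubs
    (stub_nonAdditive_of_rungK3_of_x11aThree_sharp_of_tamagawa_le_deepInfty hYZ hW20 hW hSk hmod hGZK hM hBCDT
      hLL hMi hK3 hT3 hTD)
    (stub19679_additiveDefect_of_fineKatoAll hS24 hS24₂ hGZK hPT hC1)

/-! ### §5 The parent crux 19075 BY NAME -/

/-- **The PARENT crux `DeepLowerAtThree` (item 19075) BY NAME**: w2-c2's §L glue `deepLowerAtThree_of_parts` on the alias
`KatoStratumSharedParts` (item 19678) and §4 ([S24]/GZK/PT from the alias).  CONDITIONAL: does not close 19075.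
[cite: Kim2025RefinedTNC, Thm 1.1] [cite: Sakamoto2024, Thm. 4.4 (p. 926)] [cite: MazurRubin2004, Thm. 5.2.12] [cite: Carayol1986]
[cite: MilneADT2006, Ch. I, Thm. 4.10] -/
theorem deepLowerAtThree_of_katoStratumSharedParts_of_cornerKeys_of_fineKatoAll
    (hK : KatoStratumSharedParts)
    (hYZ : YanZhu2026.thm415_padicValRat_bsd_rank_le_one)
    (hW20 : Wuthrich2014.lemma20_surjective_threeAdic_of_semistable)
    (hW : Wuthrich2014.sha_dvd_analyticSha)
    (hSk : Skinner2016.thmC_padicValRat_bsd_rank_zero)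
    (hmod : hasEntireLFunction_rat)
    (hM : mazur_not_dvd_maninConstant_of_odd)
    (hBCDT : exists_isNewformOf) (hLL : diamond1995_refinedSerre)
    (hMi : bsdp_of_irreducible_of_conductor_lt)
    (hK3 : Supersingular.SignedSupersingular) (hT3 : X11a.TargetThree) (hTD : TAMDIV)
    (hC1 : FINEKATOALL) :
    DeepLowerAtThree := by
  obtain ⟨hSak, hGZK, hPT, hlev, hPort⟩ := hK
  exact deepLowerAtThree_of_parts hSak hGZK hPT hlev hPort
    (deepLowerAtThreeOffKatoStratum_of_cornerKeys_of_fineKatoAll hYZ hW20 hW hSk hmod hGZK hM hBCDT hLL hMi hSak.1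
      hSak.2 hPT hK3 hT3 hTD hC1)

end Summit.BirchSwinnertonDyer.BirchSwinnertonDyer.Theorems.KimAtThreeOffStratumAdditiveOfFineKatoAll

end
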